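import Summits.QuantumFields.YangMills.Theorems.UnitScaleTiltHalvingP1FlatPillarRoomOfSuppliers
import HarnessLib

/-!
# Route `UnitScaleTilt`, crux K1 child «MinimiserStabilityRegPr» (stmt-QuantumFields-19200), registered stub V2′ `stub_halvingStep` (v10 `BirthV10`) —
# **LEAD-H RULING L-11 (ρ-WINDOW): THE CONSTANTS WRAPPER FOR THE REPAIRED DISPLAY — `hP1roomρ2_of_suppliers (hSupUρ) : hP1roomρ`**, the twin of
# ✓`HalvingP1FlatPillarRoomOfSuppliers.hP1room_of_suppliers` (★w3-19200 g6) with ONE inserted binder on both sides: `∃ Cρ : ℝ, 0 < Cρ ∧ …` after the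
# `∃ Nr` ∕ `∃ M′ ≥ 1` of the prefix and the premise `Cρ * ((ρ : ℝ) + 1) * a ≤ 1` right after the B₁-window

Cell `ym3-torus` (HUMAN RULING D-0037, YM ladder rung R3 — continuum SU(2) YM₃ on the three-torus is a RUNG, NOT the Clay problem), width seat `ym-ust-19200-w5` gen 5
(LEAD-H g5; `--supports stmt-QuantumFields-19200 --as helper`; count-neutral).  Definition-free, 0 sorry, standard axioms.

WHY (LEAD-H LOCATE `LOCATE-RHO-WINDOW-w5g5.md`, 19200 evidence #50).  The displayed texts `hSupU` ∕ `hP1room` couple the route radius `ρ` to the regularity ceiling `a`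
ONLY through `12(ρ+M)·a ≤ Cr` with `Cr > 0` free, so `ρ·ε₀ ≤ ρ·a ≤ Cr∕12` is unbounded over the prefix — while the per-site supply of the block (J3's pre-gauge chart
✓`HalvingP1FlatCoreSupplierPreGauge.exists_preGauge_chart`, window `hsmall`; Theorem 4's (1.35)∕(1.66) data `h135`∕`h66` under N05's windows) needs
`(ρ + M + L + S + M′)·ε₀` small, and gauge-invariantly a boundary field of constant curvature `ε₁ = 1∕(12(ρ+M))` forbids the block's own (1.36)♭ size rows.  The door
instantiates `a := min …` AFTER `ρ` (✓`HalvingStepOfPillarsRoomStat.roomHalvingStat_of_rows` §5), so the extra premise `Cρ·(ρ+1)·a ≤ 1` costs it one more `min`-term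
(companion file `…HalvingStubOfHP1RoomRho`).  THIS FILE is ✓p641613's proof VERBATIM with `Cρ` ∕ `hregρ` threaded: the supplier's `Cρ` is passed through unchanged (the
choices `Rₚ ↦ max Rₚ (2L)`, `B₁ ↦ max B₁ 6`, `Nr := M′ + 1 + 2(M + L + S)`, `ρ′ := ρ + M + L + S`, `R′ := R` do not touch `a`).
* ★★★ `hP1roomρ2_of_suppliers (hSupUρ) : <hP1roomρ>` — so that `stub_halvingStep_of_hP1roomρ (hP1roomρ2_of_suppliers hSupUρ)` is the registered H text from the ONE
  displayed text `hSupUρ` («H = hSupUρ», BOARD v3).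
HONEST SCOPE.  Quantifier∕constants bookkeeping over landed rows (the arithmetic bricks are ✓`HalvingP1FlatPillarRoomOfSuppliers`' §1, imported); `hSupUρ` is a HYPOTHESIS.
NOT a claim about [Balaban1985RegularSpaces] Thm 2, the stub, the crux, the rung or the mass gap; no summit statement is proved by this seat.

References: T. Bałaban, CMP **99** (1985) 75–102 [Balaban1985RegularSpaces] Thm 2 p.83, (1.33)–(1.38) p.82, (1.65)–(1.66) p.87; CMP **102** (1985) 277–309
[Balaban1985Variational] Prop 2 p.281, (144) p.300, (150)–(156) pp.301–302, (160) p.303.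
-/

set_option autoImplicit false

noncomputable section

open scoped BigOperators Matrix.Norms.L2Operator

namespace Summit.QuantumFields.YangMills.Theorems.HalvingP1FlatPillarRoomOfSuppliersRho2

open Literature.MathematicalPhysics.QuantumFieldTheory.Balaban1983to89
open Literature.MathematicalPhysics.QuantumFieldTheory.Balaban1983to89.T3ContinuumYM3Torus
open Literature.MathematicalPhysics.QuantumFieldTheory.Balaban1983to89.T3PrintedRegularMinimiser
open T4Continuum BlockAveraging ExpMeanLog T3RegularMinimiser
open Complex (I)
open MatrixLog (mlog)
open B5Eq118OneStroke (iterBlockOf)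
open B6SectAOperatorsV1 (SiteIdx)
open B7Prop1Explicit renaming Site → LSite
open B7Prop1Explicit (e)
open B7Prop1Local (InBox)
open B8Eq131Cubes (cube flm gs sqLo sqHi)
open B8Eq138LandauZd (covDivB covLap QT)
open B8CubeMemberZd (cubeLamS)
open B10Eq27TorusAxialLog (transl rel unitsField toUField suIncl gaugeActT axialT)
open B15Eq112TorusCover (lift)
open Node00 (coverAt)
open LatticeFieldCalculus (laplace diverg siteAvgIter)
open FlatCubeOpsText (IsLevWeight)
open FlatCubeSequenceAligned (cubeSeqMT3 cubeSetM)
open Summit.QuantumFields.YangMills.Theorems.Prop8ChartDoubleBar (dbarIterU vframeU)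
open HalvingP1FlatPillar (DP1Clause)
open HalvingP1FlatPillarPrime (P1FlatPillarAt')
open HalvingP1FlatCoreExtractionMult (p1FlatPillar'_room_of_mlogChartDataMult)
open HalvingP1FlatCoreChartDataDoor (mlogChartDataMult_of_suppliers_cubeLamS)
open P1FlatCoreCubeInclusion (corner_of_offset room_of_level_k)
open P1FlatCoreDP1Target (sitesPerDir_top_eq)
open HalvingP1FlatCoreFamilyDoor (p1FlatPillar'_room_of_suppliers)

open HalvingP1FlatPillarRoomOfSuppliers (cubeData_of_prefix window_mono_B₁ ha7_of_window)

/-! ## ★★★ `hP1roomρ` from the uniform supplier binder `hSupUρ` -/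

open Classical in
/-- ★★★ **RULING L-11 — THE H DOOR's `hP1roomρ` FROM THE UNIFORM SUPPLIER BINDER `hSupUρ`.**  Both texts are ✓`hP1room_of_suppliers`' with ONE inserted
binder and ONE substitution: the supplier's ρ-window constant `∃ Cρ : ℝ, 0 < Cρ ∧ …` (after `∃ Nr` ∕ after `∃ M′ ≥ 1`) with the premise `Cρ * ((ρ : ℝ) + 1) * a ≤ 1`
right after the B₁-window, and the size constant READ ρ-LINEARLY, `B₁ ↦ B₁ * ((ρ : ℝ) + 1)`, in the B₁-window, in the (1.36)♭ size rows and in `P1FlatPillarAt'` — the smallness of `(ρ + 1)·ε₀` that J3's pre-gauge chart (`hsmall`) and Theorem 4's (1.35)∕(1.66) data need at N05's member `ρ′ = ρ + M + L + S`.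
Body = ✓`HalvingP1FlatCoreFamilyDoor.p1FlatPillar'_room_of_suppliers`'s per-site ∃-block VERBATIM at `(M′, ρ′ := ρ + M + L + S, B₁)`; choices `Rₚ ↦ max Rₚ (2L)`,
`B₁ ↦ max B₁ 6`, `Nr := M′ + 1 + 2(M + L + S)`, `Cρ ↦ Cρ` (verbatim), `R′ := R` — ✓p641613's proof with `Cρ`∕`hregρ` threaded.
[cite: Balaban1985RegularSpaces, Thm 2 p.83, (1.33)-(1.38) p.82, (1.65)-(1.66) p.87; Balaban1985Variational, Prop 2 p.281, (144) p.300, (150)-(156) pp.301-302, (160) p.303] -/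
theorem hP1roomρ2_of_suppliers
    (hSupUρ2 : ∀ L : ℕ, Odd L → 1 < L → ∃ (Mₚ Rₚ : ℕ), ∀ (R M aₑ S : ℕ) (hM : 1 ≤ M), M = L ^ aₑ → Mₚ ≤ M → Rₚ ≤ R → R * M ≤ S →
      ∃ B₁ : ℝ, 0 ≤ B₁ ∧ ∃ M' : ℕ, 1 ≤ M' ∧ ∃ Cρ : ℝ, 0 < Cρ ∧
      ∀ (ρ : ℕ) (a Cr : ℝ), 0 < Cr → 12 * ((ρ : ℝ) + (M : ℝ)) * a ≤ Cr →
        16 * 3800 * ((5 * L : ℕ) : ℝ) ^ 2 * (L : ℝ) * ((B₁ * ((ρ : ℝ) + 1) + 1) * a) ≤ 1 → Cρ * ((ρ : ℝ) + 1) * a ≤ 1 →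
        ∀ F : T3Family, F.L = L → ∀ (n K : ℕ) (hnK : n < K), 2 * ρ + (M' + 1 + 2 * (M + L + S)) ≤ F.L ^ (F.m + n) →
          ∀ (ε₀ ε₁ : ℝ), 0 < ε₁ → 0 < ε₀ → ε₀ ≤ a → Cr * ε₁ ≤ ε₀ →
          ∀ V : GaugeField (F.P n) 0 (Matrix.specialUnitaryGroup (Fin 2) ℂ), PlaqSmall ε₁ V →
            ∀ U ∈ regFibrePr F n K hnK.le ε₀ V, ∀ x₀ : Site (F.P K) 0,
              ∃ (t : ℤ) (_ : 0 ≤ t) (_ : t ≤ (M' : ℤ) - 1)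
                (w : LSite (F.P K).d → Matrix.specialUnitaryGroup (Fin 2) ℂ) (X : LSite (F.P K).d → Fin (F.P K).d → Matrix (Fin 2) (Fin 2) ℂ)
                (μ : ℕ → LSite (F.P K).d → Matrix (Fin 2) (Fin 2) ℂ)
                (g h' : GaugeTransf (F.P K) 0 (Matrix (Fin 2) (Fin 2) ℂ)ˣ) (κ' : (i : ℕ) → GaugeTransf (F.P K) i (Matrix (Fin 2) (Fin 2) ℂ)ˣ)
                (ν : (i : ℕ) → Site (F.P K) i → (Matrix (Fin 2) (Fin 2) ℂ)ˣ) (gs' : (i : ℕ) → GaugeTransf (F.P K) i (Matrix (Fin 2) (Fin 2) ℂ)ˣ),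
                -- [N05 ∕ J3] chart rows and flat Landau window at the corner `a := Bᵏx₀ − t`
                (∀ z ∈ cube (F.P K).L (fun μ => ((iterBlockOf (K - n) x₀ μ).val : ℤ) - t) M' (ρ + M + L + S) (K - n) 0, ∀ ν : Fin (F.P K).d,
                  transl (0 : Site (F.P K) 0) z ∈ cubeSetM x₀ (K - n) ρ S M 0 → (transl (0 : Site (F.P K) 0) z).shift ν ∈ cubeSetM x₀ (K - n) ρ S M 0 →
                  ‖(((Unitary.toUnits (suIncl (w z)))⁻¹ * unitsField (toUField U) ⟨transl 0 z, ν⟩ * Unitary.toUnits (suIncl (w (z + e ν))) :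
                      (Matrix (Fin 2) (Fin 2) ℂ)ˣ) : Matrix (Fin 2) (Fin 2) ℂ) - 1‖ ≤ 1 / 4) ∧
                (∀ z ∈ cube (F.P K).L (fun μ => ((iterBlockOf (K - n) x₀ μ).val : ℤ) - t) M' (ρ + M + L + S) (K - n) 0, ∀ ν : Fin (F.P K).d,
                  transl (0 : Site (F.P K) 0) z ∈ cubeSetM x₀ (K - n) ρ S M 0 → (transl (0 : Site (F.P K) 0) z).shift ν ∈ cubeSetM x₀ (K - n) ρ S M 0 →
                  I • ((((F.L : ℝ)⁻¹) ^ (K - n)) • X z ν) = mlog (((Unitary.toUnits (suIncl (w z)))⁻¹ * unitsField (toUField U) ⟨transl 0 z, ν⟩ *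
                      Unitary.toUnits (suIncl (w (z + e ν))) : (Matrix (Fin 2) (Fin 2) ℂ)ˣ) : Matrix (Fin 2) (Fin 2) ℂ)) ∧
                (∀ z ∈ cube (F.P K).L (fun μ => ((iterBlockOf (K - n) x₀ μ).val : ℤ) - t) M' (ρ + M + L + S) (K - n) 0,
                  covLap (((F.L : ℝ)⁻¹) ^ (K - n)) (1 : LSite (F.P K).d → Fin (F.P K).d → (Matrix (Fin 2) (Fin 2) ℂ)ˣ)
                      ((cube (F.P K).L (fun μ => ((iterBlockOf (K - n) x₀ μ).val : ℤ) - t) M' (ρ + M + L + S) (K - n) 0).indicator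
                        (covDivB (((F.L : ℝ)⁻¹) ^ (K - n)) (1 : LSite (F.P K).d → Fin (F.P K).d → (Matrix (Fin 2) (Fin 2) ℂ)ˣ) X)) z =
                    QT (F.P K).L (K - n) (cubeLamS (F.P K).L (fun μ => ((iterBlockOf (K - n) x₀ μ).val : ℤ) - t) M' (ρ + M + L + S) (K - n) (K - n))
                      (1 : LSite (F.P K).d → Fin (F.P K).d → (Matrix (Fin 2) (Fin 2) ℂ)ˣ) μ z) ∧
                -- [top step] frames, composite gauge, top identity
                κ' 0 = h' ∧
                (∀ (i : ℕ) (y : Site (F.P K) (i + 1)),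
                  κ' (i + 1) y = (vframeU (gaugeActT (κ' i) (dbarIterU i (gaugeActT g (unitsField (toUField U))))) y)⁻¹ * κ' i (emb y) *
                    vframeU (dbarIterU i (gaugeActT g (unitsField (toUField U)))) y) ∧
                (∀ s, ν 0 s = 1) ∧
                (∀ (i : ℕ) (y : Site (F.P K) (i + 1)), ν (i + 1) y = ν i (emb y) * vframeU (dbarIterU i (gaugeActT g (unitsField (toUField U)))) y) ∧
                gs' 0 = g ∧ (∀ (i : ℕ) (y : Site (F.P K) (i + 1)), gs' (i + 1) y = gs' i (emb y)) ∧
                (∀ s, (Unitary.toUnits (suIncl (w (lift (F.P K) x₀ + rel x₀ s))))⁻¹ =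
                  ((gs' (K - n) (iterBlockOf (K - n) x₀))⁻¹ * ν (K - n) (iterBlockOf (K - n) x₀)) * h' s * g s) ∧
                (∀ yc ∈ cubeLamS (F.P K).L (fun μ => ((iterBlockOf (K - n) x₀ μ).val : ℤ) - t) M' (ρ + M + L + S) (K - n) (K - n) (K - n),
                  κ' (K - n) (coverAt (F.P K) (K - n) yc) =
                    axialT (dbarIterU (K - n) (gaugeActT g (unitsField (toUField U)))) (iterBlockOf (K - n) x₀) (coverAt (F.P K) (K - n) yc)) ∧
                -- [sizes] the two (1.36)♭ rows of `A := X ∘ rep`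
                (∀ wt : ℕ → PBond (F.P K) 0 → ℝ, IsLevWeight F n K (cubeSeqMT3 F n K x₀ ρ S M hM) wt →
                  (∀ b : PBond (F.P K) 0, wt 1 b *
                    ‖(fun b : PBond (F.P K) 0 => if b.src ∈ cubeSetM x₀ (K - n) ρ S M 0 ∧ b.tgt ∈ cubeSetM x₀ (K - n) ρ S M 0 then
                      X (lift (F.P K) x₀ + rel x₀ b.src) b.dir else 0) b‖ ≤ B₁ * ((ρ : ℝ) + 1) * ε₀) ∧
                  (∀ (b : PBond (F.P K) 0) (ν' : Fin (F.P K).d), wt 2 b * (F.L : ℝ) ^ (K - n) *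
                    ‖(fun b : PBond (F.P K) 0 => if b.src ∈ cubeSetM x₀ (K - n) ρ S M 0 ∧ b.tgt ∈ cubeSetM x₀ (K - n) ρ S M 0 then
                        X (lift (F.P K) x₀ + rel x₀ b.src) b.dir else 0) ⟨b.src.shift ν', b.dir⟩ -
                      (fun b : PBond (F.P K) 0 => if b.src ∈ cubeSetM x₀ (K - n) ρ S M 0 ∧ b.tgt ∈ cubeSetM x₀ (K - n) ρ S M 0 then
                        X (lift (F.P K) x₀ + rel x₀ b.src) b.dir else 0) b‖ ≤ B₁ * ((ρ : ℝ) + 1) * ε₀))) :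
    ∀ L : ℕ, Odd L → 1 < L → ∃ (Mₚ Rₚ : ℕ), ∀ (R M aₑ S : ℕ) (hM : 1 ≤ M), M = L ^ aₑ → Mₚ ≤ M → Rₚ ≤ R → R * M ≤ S →
      ∃ B₁ : ℝ, 0 ≤ B₁ ∧ ∃ Nr : ℕ, ∃ Cρ : ℝ, 0 < Cρ ∧
      ∀ (ρ : ℕ) (a Cr : ℝ), 0 < Cr → 12 * ((ρ : ℝ) + (M : ℝ)) * a ≤ Cr →
        16 * 3800 * ((5 * L : ℕ) : ℝ) ^ 2 * (L : ℝ) * ((B₁ * ((ρ : ℝ) + 1) + 1) * a) ≤ 1 → Cρ * ((ρ : ℝ) + 1) * a ≤ 1 →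
        ∀ F : T3Family, F.L = L → ∀ (n K : ℕ) (hnK : n < K), 2 * ρ + Nr ≤ F.L ^ (F.m + n) →
          ∀ (ε₀ ε₁ : ℝ), 0 < ε₁ → 0 < ε₀ → ε₀ ≤ a → Cr * ε₁ ≤ ε₀ →
          ∀ V : GaugeField (F.P n) 0 (Matrix.specialUnitaryGroup (Fin 2) ℂ), PlaqSmall ε₁ V →
            ∀ U ∈ regFibrePr F n K hnK.le ε₀ V, ∀ x : Site (F.P K) 0,
              P1FlatPillarAt' F n K (cubeSeqMT3 F n K x ρ S M hM) (cubeSetM x (K - n) ρ S M 0) x ε₀ ε₁ (B₁ * ((ρ : ℝ) + 1)) 6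
                (8 * (L : ℝ) * (B₁ * ((ρ : ℝ) + 1) + 1)) U := by
  intro L hodd hL
  obtain ⟨Mₚ, Rₚ, h⟩ := hSupUρ2 L hodd hL
  refine ⟨Mₚ, max Rₚ (2 * L), fun R M aₑ S hM hMe hMₚ hRₚ hRS => ?_⟩
  have hR : Rₚ ≤ R := le_trans (le_max_left _ _) hRₚ
  have h2L : 2 * L ≤ R := le_trans (le_max_right _ _) hRₚ
  obtain ⟨B₁, hB₁, M', _hM', Cρ, hCρ, hbody⟩ := h R M aₑ S hM hMe hMₚ hR hRS
  obtain ⟨hRM, hS⟩ := cubeData_of_prefix hL hM h2L hRS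
  refine ⟨max B₁ 6, hB₁.trans (le_max_left _ _), M' + 1 + 2 * (M + L + S), Cρ, hCρ, fun ρ a Cr hCr hreg₁ hreg₀ hregρ => ?_⟩
  have hρ1 : (1 : ℝ) ≤ (ρ : ℝ) + 1 := by linarith only [(Nat.cast_nonneg ρ : (0 : ℝ) ≤ ρ)]
  have h6 : (6 : ℝ) ≤ max B₁ 6 * ((ρ : ℝ) + 1) :=
    (le_max_right B₁ 6).trans (le_mul_of_one_le_right (le_trans (by norm_num) (le_max_right B₁ 6)) hρ1)
  have hB₁ρ : 0 ≤ B₁ * ((ρ : ℝ) + 1) := mul_nonneg hB₁ (by linarith only [hρ1])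
  have hB₁' : 0 ≤ max B₁ 6 * ((ρ : ℝ) + 1) + 1 := by linarith only [h6]
  have ha7 : 10 ^ 7 * (L : ℝ) ^ 3 * a ≤ 1 := ha7_of_window h6 hreg₀
  have hmono : B₁ * ((ρ : ℝ) + 1) ≤ max B₁ 6 * ((ρ : ℝ) + 1) := mul_le_mul_of_nonneg_right (le_max_left _ _) (by linarith only [hρ1])
  have hreg₀' : 16 * 3800 * ((5 * L : ℕ) : ℝ) ^ 2 * (L : ℝ) * ((B₁ * ((ρ : ℝ) + 1) + 1) * a) ≤ 1 := window_mono_B₁ hB₁ρ hmono hreg₀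
  have hNr : M ≤ M' + 1 + 2 * (M + L + S) := by omega
  have hρ' : 2 ≤ ρ + M + L + S := by omega
  have h0 : ρ + M ≤ ρ + M + L + S + 1 := by omega
  have h1 : L + S + M ≤ ρ + M + L + S + 2 := by omega
  have hNrW : M' + 1 + 2 * (ρ + M + L + S) ≤ 2 * ρ + (M' + 1 + 2 * (M + L + S)) := by omega
  refine p1FlatPillar'_room_of_suppliers L ρ S M (M' + 1 + 2 * (M + L + S)) hM hRS hRM hS hNr hCr hreg₁ hreg₀ hB₁' ha7
    M' (ρ + M + L + S) hρ' h0 h1 hNrW fun F hF n K hnK hroom ε₀ ε₁ hε₁ hε₀ hε₀a hCrε V hV U hU x₀ => ?_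
  obtain ⟨t, ht0, ht, w, X, μ, g, h', κ', ν, gs', hWnear, hX, hLan, h0', hs', hν0, hνs, hg0, hgs, hug, htop, hsize⟩ :=
    hbody ρ a Cr hCr hreg₁ hreg₀' hregρ F hF n K hnK hroom ε₀ ε₁ hε₁ hε₀ hε₀a hCrε V hV U hU x₀
  refine ⟨t, ht0, ht, w, X, μ, g, h', κ', ν, gs', hWnear, hX, hLan, h0', hs', hν0, hνs, hg0, hgs, hug, htop, fun wt hwt => ⟨fun b => ?_, fun b ν' => ?_⟩⟩
  · exact ((hsize wt hwt).1 b).trans (mul_le_mul_of_nonneg_right hmono hε₀.le)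
  · exact ((hsize wt hwt).2 b ν').trans (mul_le_mul_of_nonneg_right hmono hε₀.le)

end Summit.QuantumFields.YangMills.Theorems.HalvingP1FlatPillarRoomOfSuppliersRho2

end
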